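import Mathlib
import Summits.ValiantsHypothesis.ValiantsHypothesis.Theorems.BarrierLeverPartitionMinorsHitByVPHiddenStatesPascalCut

/-!
# Route BarrierLever — item `PartitionMinorsHitByVP` (stmt-ValiantsHypothesis-19717), line `hidden-states`:
# MERGE CUTS ARE AFFINELY CLOSED — the weighted ball game's extra move needs no side condition either

Helper file (`--supports stmt-ValiantsHypothesis-19717`; cell valiant-natproofs, rung V4, 𝒟-side door (c), registered line
`Cruxes/PartitionMinorsHitByVP/Lines/hidden_states.lean` v4, stubs `stub_universalJoinWide` / `stub_fit`; prover seat val-np-p6 gen 8).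
No definitions. Closes NO item.

THE POINT (memo val-np-p6 g8 §5★; PROBLEM-BallGame-valnp6-g8.md §8). The Pascal-only ball game fails from h = 10 on (a deep and narrow row
family at (h,r) = (10,176)); adding the MERGE cut of the antipodal/self-dual theorem — the class {J : [a ∈ J] = [b ∈ J]} of a part, zero set
of `y_a − y_b`, whose complement {J : exactly one of a, b ∈ J} is the zero set of `y_a + y_b − 1` — repairs it (WEIGHTED BALL GAME: parts are
weighted threshold balls `{J : Σ w_q [q ∈ J] ≤ τ}` and twins). This file proves that both merge classes satisfy the affine-closure hypothesis
of the constant-free split node for free (`affRow_notMem_span_of_diag`, `affRow_notMem_span_of_antidiag`): on the span of the affine row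
vectors of a diag class the `a`- and `b`-coordinates agree, on that of an anti-diag class they sum to the `none`-coordinate, and the outside
columns violate these identities. `symGood_of_ballSplit` packages all SIX piece-wise modes of the weighted ball game (all / none / avoid q /
contain q / diag a b / anti-diag a b) into one split node with no affine-geometric hypothesis: every winning play of the weighted ball game
is, node by node, a kernel certificate (leaves by `symGood_of_affFree`, p589275).

WHAT THIS IS NOT: no family is certified here; WBALL-LADDER is a conjecture; item 19717 OPEN; nothing on crux 14610 or VP ≠ VNP.
-/

set_option linter.dupNamespace false

namespace Summit.ValiantsHypothesis.ValiantsHypothesis.Theorems.BarrierLever.HiddenStates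

open Finset Matrix MvPolynomial

noncomputable section

namespace SymbJoin

variable {h m K r r₀ r₁ : ℕ}

/-- **Diag classes are affinely closed.** If every member set of the class contains `a` iff it contains `b`, and `J` contains exactly one
of them, then the affine row vector of `J` is not in the span of the class. -/
theorem affRow_notMem_span_of_diag (a b : Fin K) (S : Set (Finset (Fin K))) (hS : ∀ J' ∈ S, (a ∈ J' ↔ b ∈ J'))
    (J : Finset (Fin K)) (hJ : ¬ (a ∈ J ↔ b ∈ J)) :
    (fun o : Option (Fin K) => Option.elim o (1 : ℂ) fun q' => if q' ∈ J then 1 else 0) ∉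
      Submodule.span ℂ ((fun J' => fun o : Option (Fin K) => Option.elim o (1 : ℂ) fun q' => if q' ∈ J' then 1 else 0) '' S) := by
  classical
  intro hmem
  have heq : ∀ v ∈ Submodule.span ℂ ((fun J' => fun o : Option (Fin K) => Option.elim o (1 : ℂ) fun q' => if q' ∈ J' then 1 else 0) '' S),
      v (some a) = v (some b) := by
    intro v hv
    induction hv using Submodule.span_induction with
    | mem x hx =>
      obtain ⟨J', hJ', rfl⟩ := hx
      by_cases ha : a ∈ J'
      · simp [ha, (hS J' hJ').mp ha]
      · have hb : b ∉ J' := fun hb => ha ((hS J' hJ').mpr hb)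
        simp [ha, hb]
    | zero => rfl
    | add x y _ _ hx hy => simp [hx, hy]
    | smul c x _ hx => simp [hx]
  have := heq _ hmem
  by_cases ha : a ∈ J
  · have hb : b ∉ J := fun hb => hJ ⟨fun _ => hb, fun _ => ha⟩
    simp [ha, hb] at this
  · have hb : b ∈ J := by
      by_contra hb; exact hJ ⟨fun h' => absurd h' ha, fun h' => absurd h' hb⟩
    simp [ha, hb] at this

/-- **Anti-diag classes are affinely closed.** If every member set of the class contains exactly one of `a`, `b`, and `J` contains both or
neither, then the affine row vector of `J` is not in the span of the class. -/
theorem affRow_notMem_span_of_antidiag (a b : Fin K) (S : Set (Finset (Fin K))) (hS : ∀ J' ∈ S, ¬ (a ∈ J' ↔ b ∈ J'))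
    (J : Finset (Fin K)) (hJ : (a ∈ J ↔ b ∈ J)) :
    (fun o : Option (Fin K) => Option.elim o (1 : ℂ) fun q' => if q' ∈ J then 1 else 0) ∉
      Submodule.span ℂ ((fun J' => fun o : Option (Fin K) => Option.elim o (1 : ℂ) fun q' => if q' ∈ J' then 1 else 0) '' S) := by
  classical
  intro hmem
  have hsum : ∀ v ∈ Submodule.span ℂ ((fun J' => fun o : Option (Fin K) => Option.elim o (1 : ℂ) fun q' => if q' ∈ J' then 1 else 0) '' S),
      v (some a) + v (some b) = v none := by
    intro v hv
    induction hv using Submodule.span_induction with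
    | mem x hx =>
      obtain ⟨J', hJ', rfl⟩ := hx
      by_cases ha : a ∈ J'
      · have hb : b ∉ J' := fun hb => hS J' hJ' ⟨fun _ => hb, fun _ => ha⟩
        simp [ha, hb]
      · have hb : b ∈ J' := by
          by_contra hb; exact hS J' hJ' ⟨fun h' => absurd h' ha, fun h' => absurd h' hb⟩
        simp [ha, hb]
    | zero => simp
    | add x y _ _ hx hy =>
      simp only [Pi.add_apply]
      rw [← hx, ← hy]; ring
    | smul c x _ hx =>
      simp only [Pi.smul_apply, smul_eq_mul]
      rw [← hx]; ring
  have := hsum _ hmem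
  by_cases ha : a ∈ J
  · have hb : b ∈ J := hJ.mp ha
    simp [ha, hb] at this
  · have hb : b ∉ J := fun hb => ha (hJ.mpr hb)
    simp [ha, hb] at this

/-- **THE BALL-GAME SPLIT NODE (Pascal + merge).** As `symGood_of_affSplit`, but the deletion class is piece-wise one of the six modes of the
weighted ball game: `0` all, `1` none, `2` avoid `q p`, `3` contain `q p`, `4` diag (`q p ∈ J ↔ q' p ∈ J`), `5` anti-diag. No affine
hypothesis is needed. -/
theorem symGood_of_ballSplit (u : Fin r → Finset (Fin h)) (e : Fin r → Fin m × Finset (Fin K)) (x : Fin h) (hr : r₀ + r₁ = r)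
    (f₀ : Fin r₀ → Fin r) (f₁ : Fin r₁ → Fin r) (g₀ : Fin r₀ → Fin r) (g₁ : Fin r₁ → Fin r)
    (hf : Function.Injective (Sum.elim f₀ f₁)) (hg : Function.Injective (Sum.elim g₀ g₁))
    (hrow0 : ∀ j, x ∉ u (f₀ j)) (hrow1 : ∀ j, x ∈ u (f₁ j))
    (mode : Fin m → Fin 6) (q q' : Fin m → Fin K)
    (hmode : ∀ k, k ∈ Finset.univ.image g₀ ↔
      (mode (e k).1 = 0 ∨ (mode (e k).1 = 2 ∧ q (e k).1 ∉ (e k).2) ∨ (mode (e k).1 = 3 ∧ q (e k).1 ∈ (e k).2) ∨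
       (mode (e k).1 = 4 ∧ (q (e k).1 ∈ (e k).2 ↔ q' (e k).1 ∈ (e k).2)) ∨
       (mode (e k).1 = 5 ∧ ¬ (q (e k).1 ∈ (e k).2 ↔ q' (e k).1 ∈ (e k).2))))
    (h0 : symDet (fun j : Fin r₀ => u (f₀ j)) (fun j => e (g₀ j)) ≠ 0)
    (h1 : symDet (fun j : Fin r₁ => (u (f₁ j)).erase x) (fun j => e (g₁ j)) ≠ 0) :
    symDet u e ≠ 0 := by
  classical
  refine symGood_of_affSplit u e x hr f₀ f₁ g₀ g₁ hf hg hrow0 hrow1 ?_ h0 h1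
  intro k hk
  set p := (e k).1 with hp
  have hk' := fun hh => hk ((hmode k).mpr hh)
  have hsub : ((fun k' => fun o : Option (Fin K) => Option.elim o (1 : ℂ) fun q'' => if q'' ∈ (e k').2 then 1 else 0) ''
        {k' | k' ∈ Finset.univ.image g₀ ∧ (e k').1 = (e k).1})
      ⊆ ((fun J' => fun o : Option (Fin K) => Option.elim o (1 : ℂ) fun q'' => if q'' ∈ J' then 1 else 0) ''
        {J' | ∃ k', k' ∈ Finset.univ.image g₀ ∧ (e k').1 = (e k).1 ∧ (e k').2 = J'}) := by
    rintro v ⟨k', ⟨hk'0, hk'p⟩, rfl⟩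
    exact ⟨(e k').2, ⟨k', hk'0, hk'p, rfl⟩, rfl⟩
  intro hmem
  have hmem' := Submodule.span_mono hsub hmem
  -- every class member k' of the piece satisfies the mode condition of the piece
  have hcls : ∀ J' ∈ {J' | ∃ k', k' ∈ Finset.univ.image g₀ ∧ (e k').1 = (e k).1 ∧ (e k').2 = J'},
      (mode p = 0 ∨ (mode p = 2 ∧ q p ∉ J') ∨ (mode p = 3 ∧ q p ∈ J') ∨ (mode p = 4 ∧ (q p ∈ J' ↔ q' p ∈ J')) ∨
       (mode p = 5 ∧ ¬ (q p ∈ J' ↔ q' p ∈ J'))) := by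
    rintro J' ⟨k', hk'0, hk'p, rfl⟩
    have := (hmode k').mp hk'0
    rw [hk'p] at this
    exact this
  have key : ∀ {c d : Fin 6}, mode p = c → mode p = d → c ≠ d → False := fun hc hd hne => hne (hc.symm.trans hd)
  have hm : mode p = 0 ∨ mode p = 1 ∨ mode p = 2 ∨ mode p = 3 ∨ mode p = 4 ∨ mode p = 5 := by
    have := (mode p).2; omega
  rcases hm with h0m | h1m | h2m | h3m | h4m | h5m
  · exact hk' (Or.inl h0m)
  · -- none: empty class
    have hempty : {J' | ∃ k', k' ∈ Finset.univ.image g₀ ∧ (e k').1 = (e k).1 ∧ (e k').2 = J'} = (∅ : Set (Finset (Fin K))) := by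
      ext J'
      simp only [Set.mem_empty_iff_false, iff_false]
      intro hJ'
      rcases hcls J' hJ' with h' | ⟨h', _⟩ | ⟨h', _⟩ | ⟨h', _⟩ | ⟨h', _⟩
      · exact key h' h1m (by decide)
      · exact key h' h1m (by decide)
      · exact key h' h1m (by decide)
      · exact key h' h1m (by decide)
      · exact key h' h1m (by decide)
    rw [hempty, Set.image_empty, Submodule.span_empty] at hmem'
    have := congrFun ((Submodule.mem_bot ℂ).mp hmem') none
    simp at this
  · have hqk : q p ∈ (e k).2 := by
      by_contra hq; exact hk' (Or.inr (Or.inl ⟨h2m, hq⟩))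
    refine affRow_notMem_span_of_avoid (q p) _ ?_ (e k).2 hqk hmem'
    intro J' hJ'
    rcases hcls J' hJ' with h' | ⟨_, h'⟩ | ⟨h', _⟩ | ⟨h', _⟩ | ⟨h', _⟩
    · exact (key h' h2m (by decide)).elim
    · exact h'
    · exact (key h' h2m (by decide)).elim
    · exact (key h' h2m (by decide)).elim
    · exact (key h' h2m (by decide)).elim
  · have hqk : q p ∉ (e k).2 := fun hq => hk' (Or.inr (Or.inr (Or.inl ⟨h3m, hq⟩)))
    refine affRow_notMem_span_of_contain (q p) _ ?_ (e k).2 hqk hmem'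
    intro J' hJ'
    rcases hcls J' hJ' with h' | ⟨h', _⟩ | ⟨_, h'⟩ | ⟨h', _⟩ | ⟨h', _⟩
    · exact (key h' h3m (by decide)).elim
    · exact (key h' h3m (by decide)).elim
    · exact h'
    · exact (key h' h3m (by decide)).elim
    · exact (key h' h3m (by decide)).elim
  · have hqk : ¬ (q p ∈ (e k).2 ↔ q' p ∈ (e k).2) := fun hq => hk' (Or.inr (Or.inr (Or.inr (Or.inl ⟨h4m, hq⟩))))
    refine affRow_notMem_span_of_diag (q p) (q' p) _ ?_ (e k).2 hqk hmem'
    intro J' hJ'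
    rcases hcls J' hJ' with h' | ⟨h', _⟩ | ⟨h', _⟩ | ⟨_, h'⟩ | ⟨h', _⟩
    · exact (key h' h4m (by decide)).elim
    · exact (key h' h4m (by decide)).elim
    · exact (key h' h4m (by decide)).elim
    · exact h'
    · exact (key h' h4m (by decide)).elim
  · have hqk : (q p ∈ (e k).2 ↔ q' p ∈ (e k).2) := by
      by_contra hq; exact hk' (Or.inr (Or.inr (Or.inr (Or.inr ⟨h5m, hq⟩))))
    refine affRow_notMem_span_of_antidiag (q p) (q' p) _ ?_ (e k).2 hqk hmem'
    intro J' hJ'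
    rcases hcls J' hJ' with h' | ⟨h', _⟩ | ⟨h', _⟩ | ⟨h', _⟩ | ⟨_, h'⟩
    · exact (key h' h5m (by decide)).elim
    · exact (key h' h5m (by decide)).elim
    · exact (key h' h5m (by decide)).elim
    · exact (key h' h5m (by decide)).elim
    · exact h'

end SymbJoin

end

end Summit.ValiantsHypothesis.ValiantsHypothesis.Theorems.BarrierLever.HiddenStates
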